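import Mathlib.Analysis.SpecialFunctions.Pow.Real
import Mathlib.Algebra.BigOperators.Intervals
import HarnessLib

/-!
# `RigorousRGSmallParameter` (Slade, Theorem 1.4.1): discrete bump functions on `ℤ` with `K`
# controlled finite differences — the one-dimensional factor of the lattice cutoff `χ_t` of
# [BS-rg-loc] Lemma 3.3.1

Companion ("proof architecture") file of
`Literature/Barriers/CriticalPhenomena/RigorousRGSmallParameter.lean` (Loc norm-estimates layer,
[BS-rg-loc] §3.3). [BS-rg-loc] Lemma 3.3.1 uses "a `t`-dependent function `χ : ℝ^d → [0,1]`" equal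
to `1` on `X`, `0` off `X_{2t}`, whose lattice derivatives cost `(c₀/(tR))` each, to pass from the
localised norm `‖g‖_{Φ(X)}` to `‖gχ_t‖_Φ`. Here the one-dimensional factor is built DIRECTLY ON THE
LATTICE: the `K`-fold box average `B_w^K` of an indicator (a discrete spline), which is `1` on the
prescribed interval, `0` at distance `> K(w-1)`, takes values in `[0,1]`, and satisfies
`|Δ^k B_w^K 𝟙| ≤ (2/w)^k` for `k ≤ K` (each difference telescopes one box average:
`ΔB_w = w⁻¹(τ_1 - τ_{1-w})`). All PROVED, 0 sorry:

* `fwdDiff`, `shiftZ`, `boxAvg`, `boxIter` with their algebra (`fwdDiff_sub/_smul/_shiftZ`,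
  `iter_fwdDiff_sub/_smul/_shiftZ`, `boxAvg_shiftZ`, `boxIter_shiftZ`), **`fwdDiff_boxAvg`**
  (telescoping), `abs_boxAvg_le`, `abs_boxIter_le`, **`abs_iter_fwdDiff_boxIter_le`**
  (`|Δ^k B_w^K f| ≤ C(2/w)^k`, `k ≤ K`);
* plateau/support/range: `boxAvg_eq_one/_eq_zero`, `boxIter_eq_one/_eq_zero`, `boxIter_mem_Icc`;
* the bump `bumpZ u v w K = B_w^K 𝟙_{[u-K(w-1), v]}`: **`bumpZ_eq_one`** (on `[u,v]`),
  **`bumpZ_eq_zero`** (off `[u-K(w-1), v+K(w-1)]`), `bumpZ_mem_Icc`, **`abs_iter_fwdDiff_bumpZ_le`**.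

Sources: D. C. Brydges, G. Slade, *A renormalisation group method. II. Approximation by local
polynomials*, J. Stat. Phys. 159 (2015) 461–491, arXiv:1403.7253, §3.3 (proof of Lemma 3.3.1, the
cutoff `χ_t`), TeX-source numbering; the discrete construction is folklore.

## References

* [BrydgesSlade2015RGII] D. C. Brydges, G. Slade, *A renormalisation group method. II.
  Approximation by local polynomials*, J. Stat. Phys. **159** (2015) 461–491, arXiv:1403.7253.
-/

noncomputable section

namespace Literature.Barriers.CriticalPhenomena

namespace LongRangePhi4

namespace Bump

open Finset

/-- Forward difference on `ℤ`. [folklore] -/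
def fwdDiff (f : ℤ → ℝ) : ℤ → ℝ := fun t => f (t + 1) - f t

/-- Translation `(τ_a f)(t) = f(t + a)`. [folklore] -/
def shiftZ (a : ℤ) (f : ℤ → ℝ) : ℤ → ℝ := fun t => f (t + a)

/-- The box average over the `w` preceding points: `(B_w f)(t) = w⁻¹ Σ_{i<w} f(t - i)`. [folklore] -/
def boxAvg (w : ℕ) (f : ℤ → ℝ) : ℤ → ℝ := fun t => (w : ℝ)⁻¹ * ∑ i ∈ range w, f (t - i)

/-- `K`-fold box average. [folklore] -/
def boxIter (w K : ℕ) (f : ℤ → ℝ) : ℤ → ℝ := (boxAvg w)^[K] f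

/-! ### Algebra of differences, shifts and box averages -/

/-- `Δ` is additive. [folklore] -/
theorem fwdDiff_sub (f g : ℤ → ℝ) : fwdDiff (f - g) = fwdDiff f - fwdDiff g := by
  funext t; simp [fwdDiff]; ring

/-- `Δ` is homogeneous. [folklore] -/
theorem fwdDiff_smul (c : ℝ) (f : ℤ → ℝ) : fwdDiff (c • f) = c • fwdDiff f := by
  funext t; simp [fwdDiff]; ring

/-- `Δ` commutes with translations. [folklore] -/
theorem fwdDiff_shiftZ (a : ℤ) (f : ℤ → ℝ) : fwdDiff (shiftZ a f) = shiftZ a (fwdDiff f) := by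
  funext t; simp only [fwdDiff, shiftZ]; ring_nf

/-- `Δ^k` is additive. [folklore] -/
theorem iter_fwdDiff_sub (k : ℕ) (f g : ℤ → ℝ) : fwdDiff^[k] (f - g) = fwdDiff^[k] f - fwdDiff^[k] g := by
  induction k generalizing f g with
  | zero => rfl
  | succ k ih => rw [Function.iterate_succ_apply, Function.iterate_succ_apply, Function.iterate_succ_apply, fwdDiff_sub, ih]

/-- `Δ^k` is homogeneous. [folklore] -/
theorem iter_fwdDiff_smul (k : ℕ) (c : ℝ) (f : ℤ → ℝ) : fwdDiff^[k] (c • f) = c • fwdDiff^[k] f := by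
  induction k generalizing f with
  | zero => rfl
  | succ k ih => rw [Function.iterate_succ_apply, Function.iterate_succ_apply, fwdDiff_smul, ih]

/-- `Δ^k` commutes with translations. [folklore] -/
theorem iter_fwdDiff_shiftZ (k : ℕ) (a : ℤ) (f : ℤ → ℝ) : fwdDiff^[k] (shiftZ a f) = shiftZ a (fwdDiff^[k] f) := by
  induction k generalizing f with
  | zero => rfl
  | succ k ih => rw [Function.iterate_succ_apply, Function.iterate_succ_apply, fwdDiff_shiftZ, ih]

/-- `B_w` commutes with translations. [folklore] -/
theorem boxAvg_shiftZ (w : ℕ) (a : ℤ) (f : ℤ → ℝ) : boxAvg w (shiftZ a f) = shiftZ a (boxAvg w f) := by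
  funext t
  simp only [boxAvg, shiftZ]
  congr 1
  exact Finset.sum_congr rfl fun i _ => by ring_nf

/-- `B_w^K` commutes with translations. [folklore] -/
theorem boxIter_shiftZ (w K : ℕ) (a : ℤ) (f : ℤ → ℝ) : boxIter w K (shiftZ a f) = shiftZ a (boxIter w K f) := by
  induction K generalizing f with
  | zero => rfl
  | succ K ih =>
      show (boxAvg w)^[K + 1] (shiftZ a f) = shiftZ a ((boxAvg w)^[K + 1] f)
      rw [Function.iterate_succ_apply, Function.iterate_succ_apply, boxAvg_shiftZ]
      exact ih _

/-- **Telescoping**: `Δ(B_w f)(t) = w⁻¹(f(t+1) - f(t+1-w))`, i.e. `Δ B_w = w⁻¹(τ_1 - τ_{1-w})`. [folklore] -/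
theorem fwdDiff_boxAvg {w : ℕ} (hw : 1 ≤ w) (f : ℤ → ℝ) :
    fwdDiff (boxAvg w f) = (w : ℝ)⁻¹ • (shiftZ 1 f - shiftZ (1 - w) f) := by
  funext t
  simp only [fwdDiff, boxAvg, Pi.smul_apply, Pi.sub_apply, shiftZ, smul_eq_mul]
  rw [← mul_sub]
  congr 1
  obtain ⟨v, rfl⟩ : ∃ v, w = v + 1 := ⟨w - 1, by omega⟩
  rw [Finset.sum_range_succ' (fun i => f (t + 1 - (i : ℤ))), Finset.sum_range_succ (fun i => f (t - (i : ℤ)))]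
  have e : ∀ i : ℕ, f (t + 1 - ((i + 1 : ℕ) : ℤ)) = f (t - (i : ℤ)) := fun i => by push_cast; ring_nf
  simp only [e]
  push_cast
  ring_nf

/-! ### Sup bounds and the difference estimate -/

/-- `B_w` preserves sup bounds. [folklore] -/
theorem abs_boxAvg_le {w : ℕ} (hw : 1 ≤ w) {f : ℤ → ℝ} {C : ℝ} (hf : ∀ t, |f t| ≤ C) (t : ℤ) : |boxAvg w f t| ≤ C := by
  unfold boxAvg
  have hw' : (0 : ℝ) < w := by exact_mod_cast hw
  rw [abs_mul, abs_of_pos (inv_pos.2 hw')]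
  calc (w : ℝ)⁻¹ * |∑ i ∈ range w, f (t - i)| ≤ (w : ℝ)⁻¹ * ∑ i ∈ range w, C := by
        gcongr
        exact (Finset.abs_sum_le_sum_abs _ _).trans (Finset.sum_le_sum fun i _ => hf _)
    _ = C := by rw [Finset.sum_const, Finset.card_range, nsmul_eq_mul]; field_simp

/-- `B_w^K` preserves sup bounds. [folklore] -/
theorem abs_boxIter_le {w : ℕ} (hw : 1 ≤ w) (K : ℕ) {f : ℤ → ℝ} {C : ℝ} (hf : ∀ t, |f t| ≤ C) (t : ℤ) :
    |boxIter w K f t| ≤ C := by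
  induction K generalizing t with
  | zero => exact hf t
  | succ K ih =>
      show |(boxAvg w)^[K + 1] f t| ≤ C
      rw [Function.iterate_succ_apply']
      exact abs_boxAvg_le hw ih t

/-- **`|Δ^k B_w^K f| ≤ C (2/w)^k` for `k ≤ K` and `|f| ≤ C`** — each difference falls on one box
average and costs `2/w`. [folklore] -/
theorem abs_iter_fwdDiff_boxIter_le {w : ℕ} (hw : 1 ≤ w) :
    ∀ (k K : ℕ) (f : ℤ → ℝ) (C : ℝ), k ≤ K → (∀ t, |f t| ≤ C) → ∀ t, |fwdDiff^[k] (boxIter w K f) t| ≤ C * (2 / w) ^ k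
  | 0, K, f, C, _, hf, t => by simpa using abs_boxIter_le hw K hf t
  | k + 1, 0, f, C, h, _, t => absurd h (by omega)
  | k + 1, K + 1, f, C, hk, hf, t => by
      have hw' : (0 : ℝ) < w := by exact_mod_cast hw
      set g := boxIter w K f with hg
      have e : boxIter w (K + 1) f = boxAvg w g := by
        show (boxAvg w)^[K + 1] f = boxAvg w ((boxAvg w)^[K] f)
        rw [Function.iterate_succ_apply']
      rw [e, Function.iterate_succ_apply, fwdDiff_boxAvg hw, iter_fwdDiff_smul, iter_fwdDiff_sub, iter_fwdDiff_shiftZ,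
        iter_fwdDiff_shiftZ]
      simp only [Pi.smul_apply, Pi.sub_apply, shiftZ, smul_eq_mul]
      have ih := abs_iter_fwdDiff_boxIter_le hw k K f C (by omega) hf
      rw [abs_mul, abs_of_pos (inv_pos.2 hw')]
      calc (w : ℝ)⁻¹ * |fwdDiff^[k] g (t + 1) - fwdDiff^[k] g (t + (1 - w))|
          ≤ (w : ℝ)⁻¹ * (C * (2 / w) ^ k + C * (2 / w) ^ k) := by
            gcongr
            exact (abs_sub _ _).trans (add_le_add (ih _) (ih _))
        _ = C * (2 / w) ^ (k + 1) := by rw [pow_succ]; field_simp; ring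

/-! ### Plateau and support -/

/-- If `g = 1` on `[u, v]` then `B_w g = 1` on `[u + (w-1), v]`. [folklore] -/
theorem boxAvg_eq_one {w : ℕ} (hw : 1 ≤ w) {g : ℤ → ℝ} {u v : ℤ} (hg : ∀ t, u ≤ t → t ≤ v → g t = 1) (t : ℤ)
    (h1 : u + (w - 1 : ℕ) ≤ t) (h2 : t ≤ v) : boxAvg w g t = 1 := by
  unfold boxAvg
  have hw' : (w : ℝ) ≠ 0 := by exact_mod_cast (show w ≠ 0 by omega)
  rw [Finset.sum_congr rfl fun i hi => hg _ ?_ ?_, Finset.sum_const, Finset.card_range, nsmul_eq_mul, mul_one,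
    inv_mul_cancel₀ hw']
  · rw [Finset.mem_range] at hi
    have : (i : ℤ) ≤ (w - 1 : ℕ) := by omega
    omega
  · rw [Finset.mem_range] at hi; omega

/-- If `g = 0` outside `[u, v]` then `B_w g = 0` outside `[u, v + (w-1)]`. [folklore] -/
theorem boxAvg_eq_zero {w : ℕ} {g : ℤ → ℝ} {u v : ℤ} (hg : ∀ t, t < u ∨ v < t → g t = 0) (t : ℤ)
    (h : t < u ∨ v + (w - 1 : ℕ) < t) : boxAvg w g t = 0 := by
  unfold boxAvg
  rw [Finset.sum_eq_zero fun i hi => hg _ ?_, mul_zero]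
  rw [Finset.mem_range] at hi
  rcases h with h | h
  · left; omega
  · right
    have : (i : ℤ) ≤ (w - 1 : ℕ) := by omega
    omega

/-- Plateau of the iterate: `f = 1` on `[u, v]` ⇒ `B_w^K f = 1` on `[u + K(w-1), v]`. [folklore] -/
theorem boxIter_eq_one {w : ℕ} (hw : 1 ≤ w) : ∀ (K : ℕ) {f : ℤ → ℝ} {u v : ℤ}, (∀ t, u ≤ t → t ≤ v → f t = 1) →
    ∀ t, u + K * (w - 1 : ℕ) ≤ t → t ≤ v → boxIter w K f t = 1
  | 0, f, u, v, hf, t, h1, h2 => hf t (by simpa using h1) h2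
  | K + 1, f, u, v, hf, t, h1, h2 => by
      show (boxAvg w)^[K + 1] f t = 1
      rw [Function.iterate_succ_apply']
      refine boxAvg_eq_one hw (u := u + K * (w - 1 : ℕ)) (v := v) (fun t' h1' h2' => boxIter_eq_one hw K hf t' h1' h2') t ?_ h2
      push_cast at h1 ⊢
      linarith

/-- Support of the iterate: `f = 0` outside `[u, v]` ⇒ `B_w^K f = 0` outside `[u, v + K(w-1)]`. [folklore] -/
theorem boxIter_eq_zero {w : ℕ} : ∀ (K : ℕ) {f : ℤ → ℝ} {u v : ℤ}, (∀ t, t < u ∨ v < t → f t = 0) →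
    ∀ t, (t < u ∨ v + K * (w - 1 : ℕ) < t) → boxIter w K f t = 0
  | 0, f, u, v, hf, t, h => hf t (by simpa using h)
  | K + 1, f, u, v, hf, t, h => by
      show (boxAvg w)^[K + 1] f t = 0
      rw [Function.iterate_succ_apply']
      refine boxAvg_eq_zero (u := u) (v := v + K * (w - 1 : ℕ)) (fun t' h' => boxIter_eq_zero K hf t' h') t ?_
      rcases h with h | h
      · exact Or.inl h
      · right; push_cast at h ⊢; linarith

/-- Range of the iterate: `0 ≤ f ≤ 1` ⇒ `0 ≤ B_w^K f ≤ 1`. [folklore] -/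
theorem boxIter_mem_Icc {w : ℕ} (hw : 1 ≤ w) : ∀ (K : ℕ) {f : ℤ → ℝ}, (∀ t, 0 ≤ f t ∧ f t ≤ 1) →
    ∀ t, 0 ≤ boxIter w K f t ∧ boxIter w K f t ≤ 1
  | 0, f, hf, t => hf t
  | K + 1, f, hf, t => by
      show 0 ≤ (boxAvg w)^[K + 1] f t ∧ (boxAvg w)^[K + 1] f t ≤ 1
      rw [Function.iterate_succ_apply']
      have ih := boxIter_mem_Icc hw K hf
      have hw' : (0 : ℝ) < w := by exact_mod_cast hw
      unfold boxAvg
      constructor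
      · exact mul_nonneg (inv_nonneg.2 hw'.le) (Finset.sum_nonneg fun i _ => (ih _).1)
      · calc (w : ℝ)⁻¹ * ∑ i ∈ range w, (boxAvg w)^[K] f (t - i) ≤ (w : ℝ)⁻¹ * ∑ i ∈ range w, (1 : ℝ) := by
              gcongr with i hi
              exact (ih _).2
          _ = 1 := by rw [Finset.sum_const, Finset.card_range, nsmul_eq_mul, mul_one, inv_mul_cancel₀ hw'.ne']

/-! ### The bump -/

/-- The indicator of `[u, v] ⊂ ℤ`. [folklore] -/
def indZ (u v : ℤ) : ℤ → ℝ := fun t => if u ≤ t ∧ t ≤ v then 1 else 0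

/-- **The discrete bump** `b = B_w^K 𝟙_{[u - K(w-1), v]}`: equal to `1` on `[u, v]`, to `0` outside
`[u - K(w-1), v + K(w-1)]`, with values in `[0,1]` and `|Δ^k b| ≤ (2/w)^k` for `k ≤ K`. [folklore] -/
def bumpZ (u v : ℤ) (w K : ℕ) : ℤ → ℝ := boxIter w K (indZ (u - K * (w - 1 : ℕ)) v)

/-- The bump is `1` on `[u, v]`. [folklore] -/
theorem bumpZ_eq_one {u v : ℤ} {w K : ℕ} (hw : 1 ≤ w) {t : ℤ} (h1 : u ≤ t) (h2 : t ≤ v) : bumpZ u v w K t = 1 := by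
  unfold bumpZ
  refine boxIter_eq_one hw K (u := u - K * (w - 1 : ℕ)) (v := v) (fun t' h1' h2' => ?_) t (by linarith) h2
  simp [indZ, h1', h2']

/-- The bump vanishes outside `[u - K(w-1), v + K(w-1)]`. [folklore] -/
theorem bumpZ_eq_zero {u v : ℤ} {w K : ℕ} {t : ℤ} (h : t < u - K * (w - 1 : ℕ) ∨ v + K * (w - 1 : ℕ) < t) :
    bumpZ u v w K t = 0 := by
  unfold bumpZ
  refine boxIter_eq_zero K (u := u - K * (w - 1 : ℕ)) (v := v) (fun t' h' => ?_) t h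
  unfold indZ
  rw [if_neg]
  omega

/-- The bump takes values in `[0, 1]`. [folklore] -/
theorem bumpZ_mem_Icc {u v : ℤ} {w K : ℕ} (hw : 1 ≤ w) (t : ℤ) : 0 ≤ bumpZ u v w K t ∧ bumpZ u v w K t ≤ 1 := by
  unfold bumpZ
  refine boxIter_mem_Icc hw K (fun t' => ?_) t
  unfold indZ; split_ifs <;> norm_num

/-- **`|Δ^k b| ≤ (2/w)^k` for `k ≤ K`.** [folklore] -/
theorem abs_iter_fwdDiff_bumpZ_le {u v : ℤ} {w K : ℕ} (hw : 1 ≤ w) {k : ℕ} (hk : k ≤ K) (t : ℤ) :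
    |fwdDiff^[k] (bumpZ u v w K) t| ≤ (2 / w) ^ k := by
  have h := abs_iter_fwdDiff_boxIter_le hw k K (indZ (u - K * (w - 1 : ℕ)) v) 1 hk (fun t' => ?_) t
  · simpa [bumpZ] using h
  · unfold indZ; split_ifs <;> norm_num

end Bump

end LongRangePhi4

end Literature.Barriers.CriticalPhenomena
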